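import Summits.QuantumFields.YangMills.Theorems.LuscherReductionRunningReductionAxialGauge
import HarnessLib

/-!
# The slow manifold in axial gauge: the comb gauge of a spatially constant configuration, and positivity of the axial kernel
# (fixed-lattice programme COARSE(L₀) — route `LuscherReduction`, crux RED stmt-QuantumFields-19978 KT-door 3b′ / crux `TwistedTraceScaling`
# stmt-QuantumFields-20203 S-BASE; design note `pub/ym-fleet/ym-luscher-20007-p1/COARSE-DESIGN.md` §10 I₁-d)

The Born–Oppenheimer SLOW coordinates are the one-site (constant) configurations `constLift L u` (`…ConstLift`: on them `K_L = K_1(L³β)` exactly).  In the comb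
gauge they are NOT constant: this file gives the exact formula.
* `lineProd_constLift` — a partial line of a constant configuration is a power: `lineProd (constLift L u) x k n = (u_k)ⁿ`;
* ★ `treeGauge_constLift` — `treeGauge (constLift L u) x = u₀^{x₀} u₁^{x₁} u₂^{x₂}` (exponents = the representatives `val ∈ [0,L)`);
* ★ `treeFix_constLift` — the comb-gauge links of the constant configuration: for `e = (x,k)`,
  `treeFix (constLift L u) e = (u₀^{x₀}u₁^{x₁}u₂^{x₂}) · u_k · (u₀^{y₀}u₁^{y₁}u₂^{y₂})⁻¹`, `y = x + ê_k` — the image of the slow manifold `u ↦ treeFix (constLift L u)|off`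
  in the axial coordinates `SU(2)^{off}` (non-trivial only on the `2L³+1` non-tree links; the wrap-around links carry the Polyakov holonomies `u_k^L`-type factors);
* `axialKernel_pos` — `0 < axialKernel β w w'` (`β ≥ 0`).
HONEST FRAMING: algebra; femto rung R2b1; not infinite volume, not a gap, not Clay.
-/

set_option autoImplicit false

noncomputable section

open MeasureTheory Filter Topology Real
open scoped Matrix ComplexConjugate BigOperators
open Literature.MathematicalPhysics.QuantumFieldTheory
open Literature.MathematicalPhysics.QuantumLattice

namespace Summit.QuantumFields.YangMills.Theorems.FemtoTransferGap

variable {L : ℕ} [NeZero L]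

/-! ## §1 The comb gauge of a constant configuration -/

omit [NeZero L] in
/-- A partial line of a constant configuration is a power of the link. [folklore] -/
theorem lineProd_constLift (u : GaugeConfig 3 1 SU2) (x : Site 3 L) (k : Fin 3) (n : ℕ) :
    lineProd (constLift L u) x k n = u (0, k) ^ n := by
  induction n with
  | zero => rfl
  | succ n ih => rw [lineProd_succ, ih, constLift_apply, pow_succ]

omit [NeZero L] in
/-- ★ **Comb transporter of a constant configuration**: `u₀^{x₀} · u₁^{x₁} · u₂^{x₂}`. [folklore] -/
theorem treeGauge_constLift (u : GaugeConfig 3 1 SU2) (x : Site 3 L) :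
    treeGauge (constLift L u) x = u (0, 0) ^ (x 0).val * u (0, 1) ^ (x 1).val * u (0, 2) ^ (x 2).val := by
  unfold treeGauge
  rw [lineProd_constLift, lineProd_constLift, lineProd_constLift]

omit [NeZero L] in
/-- ★ **Comb gauge of a constant configuration**, link by link. [folklore] -/
theorem treeFix_constLift (u : GaugeConfig 3 1 SU2) (e : Edge 3 L) :
    treeFix (constLift L u) e =
      (u (0, 0) ^ (e.1 0).val * u (0, 1) ^ (e.1 1).val * u (0, 2) ^ (e.1 2).val) * u (0, e.2) *
        (u (0, 0) ^ ((e.1.shift e.2) 0).val * u (0, 1) ^ ((e.1.shift e.2) 1).val * u (0, 2) ^ ((e.1.shift e.2) 2).val)⁻¹ := by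
  show treeGauge (constLift L u) e.1 * constLift L u e * (treeGauge (constLift L u) (e.1.shift e.2))⁻¹ = _
  rw [treeGauge_constLift, treeGauge_constLift, constLift_apply]

/-- On tree edges the formula collapses to `1` (consistency with `treeFix_eq_one_of_treeEdge`). [folklore] -/
theorem treeFix_constLift_of_treeEdge (u : GaugeConfig 3 1 SU2) {e : Edge 3 L} (he : treeEdge e = true) :
    (u (0, 0) ^ (e.1 0).val * u (0, 1) ^ (e.1 1).val * u (0, 2) ^ (e.1 2).val) * u (0, e.2) *
        (u (0, 0) ^ ((e.1.shift e.2) 0).val * u (0, 1) ^ ((e.1.shift e.2) 1).val * u (0, 2) ^ ((e.1.shift e.2) 2).val)⁻¹ = 1 := by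
  rw [← treeFix_constLift, treeFix_eq_one_of_treeEdge _ he]

/-- The slow manifold in axial coordinates: `u ↦ (treeFix (constLift L u)) |off`, with `glue` of it equal to the comb gauge of the constant configuration.
[folklore] -/
theorem glue_treeFix_constLift (u : GaugeConfig 3 1 SU2) :
    glue (fun i : OffIdx L => treeFix (constLift L u) i.1) = treeFix (constLift L u) := by
  funext e
  by_cases he : treeEdge e = true
  · rw [glue_apply_of_tree _ he, treeFix_eq_one_of_treeEdge _ he]
  · rw [glue_apply_of_not_tree _ he]

/-- Hence a gauge-invariant function evaluated on the slow manifold reads the one-site datum: `G (glue (treeFix (constLift L u)|off)) = G (constLift L u)`.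
[folklore] -/
theorem apply_glue_slow {α : Type*} {G : GaugeConfig 3 L SU2 → α}
    (hG : ∀ (g : Site 3 L → SU2) (U : GaugeConfig 3 L SU2), G (gaugeTransform g U) = G U) (u : GaugeConfig 3 1 SU2) :
    G (glue fun i : OffIdx L => treeFix (constLift L u) i.1) = G (constLift L u) := by
  rw [glue_treeFix_constLift]
  exact eq_treeFix_of_gaugeInvariant hG _

/-! ## §2 Positivity of the axial kernel -/

/-- `0 < axialKernel β w w'` for `β ≥ 0` (integral of a positive function over a probability measure). [folklore] -/
theorem axialKernel_pos {β : ℝ} (hβ : 0 ≤ β) (w w' : OffIdx L → SU2) : 0 < axialKernel β w w' := by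
  unfold axialKernel
  have hm : Measurable fun t : TreeIdx L → SU2 => transferKernel su2Rep β (glue w) (recon (t, w')) :=
    (measurable_transferKernel_left β (glue w)).comp (measurable_recon.comp (measurable_id.prodMk measurable_const))
  have hint : Integrable (fun t : TreeIdx L → SU2 => transferKernel su2Rep β (glue w) (recon (t, w'))) (Measure.pi fun _ : TreeIdx L => haarProbability SU2) :=
    Integrable.of_bound hm.aestronglyMeasurable (Real.exp (2 * β) ^ Fintype.card (Edge 3 L))
      (ae_of_all _ fun t => by rw [Real.norm_eq_abs]; exact abs_transferKernel_le_lat hβ (glue w, recon (t, w')))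
  refine (integral_pos_iff_support_of_nonneg (fun t => (transferKernel_pos _ _ _ _).le) hint).mpr ?_
  have hs : Function.support (fun t : TreeIdx L → SU2 => transferKernel su2Rep β (glue w) (recon (t, w'))) = Set.univ :=
    Set.eq_univ_of_forall fun t => (transferKernel_pos _ _ _ _).ne'
  rw [hs, measure_univ]
  exact zero_lt_one

end Summit.QuantumFields.YangMills.Theorems.FemtoTransferGap

end
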